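import Literature.NumberTheory.EllipticCurves.TateSeriesFormalCoeffTwo
import Mathlib.NumberTheory.Padics.PadicNumbers
import HarnessLib

/-!
# Route `ByReductionTypeAtTwo`, crux `MultUpperHalfAtTwo` (item stmt-BirchSwinnertonDyer-19922), TOWER road, the
# «ONE BIT AT A NON-SPLIT 2» rows: KERNEL BRICK 4 — `q · j(q) ≡ 1 (mod 8)` in `ℚ₂` for `0 < |q|₂ ≤ 1/2`

HONEST FRAMING (cell `bsd-2adic`, run/shared/lean/pub/bsd-2adic/, seat `bsd-2adic-tower-1` GEN 8, HUMAN RULINGS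
D-0036 / D-0054 / D-0074): TOOL theorems only (no definition, no named fact, no `sorry`); closes nothing by itself;
nothing booked; BSD is not proved by any of this. Part of module M3 of the KERNELISATION of the displayed MEMO binder
`MultTowerNS2.localTowerKerTwoTorsion_le_two_nonsplitTwo_of_tateUnit` (scope HOME/tower/SCOPE-hNS2one-kernel-GEN8.md, step S7
«u_q ≡ u_Δ·c₄ (mod 8)», memo PROOF-NS2ONE §6): from the integer `q`-expansion `q·j(q) = 1 + 744q + 196884q² + ⋯`
(`TateSeriesFormal.hasSum_coeff_formalXJ`, `coeff_one_formalXJ = 744`, `coeff_two_formalXJ = 196884`), for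
`q ∈ ℚ₂` with `0 < |q|₂ ≤ 1/2`: `|q·j(q) − 1|₂ ≤ 1/8`, i.e. `q·j(q) ≡ 1 (mod 8ℤ₂)` — each term
`c(n)qⁿ`, `n ≥ 1`, has `|·|₂ ≤ 1/8` (`8 ∣ 744`; `2 ∣ 196884` and `|q|² ≤ 1/4`; `|q|ⁿ ≤ 1/8` for `n ≥ 3`),
and `ℚ₂` is ultrametric. With `j(q) = j(E) = c₄³/Δ_min` this gives `q/2^k ≡ Δ_min/(2^k c₄³) ≡ u_Δ c₄ (mod 8)`,
`k = ord₂ Δ_min` (the remaining, purely algebraic half of S7).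

* `norm_coeff_formalXJ_mul_pow_succ_le` — the termwise bound; `norm_mul_tateJ_sub_one_le` — the congruence.

References: J. H. Silverman, *ATAEC* V.3.1 (b), V.5.3; Nesterenko–Philippon LNM 1752 Ch. 2 Prop. 2.1; cell memo
PROOF-NS2ONE.md §6; scope memo SCOPE-hNS2one-kernel-GEN8.md S7/M3.
-/

set_option autoImplicit false
-- the Theorems namespace of this sub repeats the summit name by design (D-0017 nested layout: Summit.<S>.<Sub>)
set_option linter.dupNamespace false

noncomputable section

namespace Summit.BirchSwinnertonDyer.BirchSwinnertonDyer.Theorems.MultTowerNS2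

open PowerSeries IsUltrametricDist Literature.NumberTheory.EllipticCurves

/-- **Termwise bound**: for `q ∈ ℚ₂` with `|q|₂ ≤ 1/2` and every `n`, `|c(n+1) q^{n+1}|₂ ≤ 1/8`, where
`c(m) = coeff m formalXJ` (`c(1) = 744 = 8·93`, `c(2) = 196884 = 4·49221`, `c(m) ∈ ℤ`). [folklore] -/
theorem norm_coeff_formalXJ_mul_pow_succ_le {q : ℚ_[2]} (hq : ‖q‖ ≤ 2⁻¹) (n : ℕ) :
    ‖((coeff (n + 1) formalXJ : ℤ) : ℚ_[2]) * q ^ (n + 1)‖ ≤ 8⁻¹ := by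
  have hq0 : 0 ≤ ‖q‖ := norm_nonneg q
  rw [norm_mul, norm_pow]
  rcases n with _ | _ | n
  · -- `n + 1 = 1`: `|744| ≤ 1/8`, `|q| ≤ 1`
    have h8 : ‖((coeff 1 formalXJ : ℤ) : ℚ_[2])‖ ≤ 8⁻¹ := by
      have h := (Padic.norm_int_le_pow_iff_dvd (p := 2) (coeff 1 formalXJ) 3).mpr
        (by rw [coeff_one_formalXJ]; norm_num)
      exact h.trans (by norm_num)
    calc ‖((coeff (0 + 1) formalXJ : ℤ) : ℚ_[2])‖ * ‖q‖ ^ (0 + 1)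
        ≤ 8⁻¹ * 1 := mul_le_mul h8 (by rw [zero_add, pow_one]; exact hq.trans (by norm_num)) (by positivity)
          (by norm_num)
      _ = 8⁻¹ := mul_one _
  · -- `n + 1 = 2`: `|196884| ≤ 1/2`, `|q|² ≤ 1/4`
    have h2 : ‖((coeff 2 formalXJ : ℤ) : ℚ_[2])‖ ≤ 2⁻¹ := by
      have h := (Padic.norm_int_le_pow_iff_dvd (p := 2) (coeff 2 formalXJ) 1).mpr
        (by rw [coeff_two_formalXJ]; norm_num)
      exact h.trans (by norm_num)
    calc ‖((coeff (1 + 1) formalXJ : ℤ) : ℚ_[2])‖ * ‖q‖ ^ (1 + 1)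
        ≤ 2⁻¹ * (2⁻¹) ^ 2 := mul_le_mul h2 (pow_le_pow_left₀ hq0 hq 2) (by positivity) (by norm_num)
      _ = 8⁻¹ := by norm_num
  · -- `n + 1 ≥ 3`: `|c| ≤ 1`, `|q|^{n+3} ≤ (1/2)³`
    have hc : ‖((coeff (n + 2 + 1) formalXJ : ℤ) : ℚ_[2])‖ ≤ 1 := Padic.norm_int_le_one _
    have hqp : ‖q‖ ^ (n + 2 + 1) ≤ (2⁻¹ : ℝ) ^ 3 := by
      calc ‖q‖ ^ (n + 2 + 1) ≤ ‖q‖ ^ 3 :=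
            pow_le_pow_of_le_one hq0 (hq.trans (by norm_num)) (by omega)
        _ ≤ (2⁻¹ : ℝ) ^ 3 := pow_le_pow_left₀ hq0 hq 3
    calc ‖((coeff (n + 2 + 1) formalXJ : ℤ) : ℚ_[2])‖ * ‖q‖ ^ (n + 2 + 1)
        ≤ 1 * (2⁻¹ : ℝ) ^ 3 := mul_le_mul hc hqp (by positivity) (by norm_num)
      _ = 8⁻¹ := by norm_num

/-- **`q · j(q) ≡ 1 (mod 8ℤ₂)`**: for `q ∈ ℚ₂` with `0 < |q|₂ ≤ 1/2` (i.e. `q ∈ 2ℤ₂ ∖ {0}`),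
`|q · tateJ q − 1|₂ ≤ 1/8`. From `q·j(q) = ∑ c(n) qⁿ` (`hasSum_coeff_formalXJ`), `c(0) = 1`, the termwise bound
and the ultrametric inequality for sums. [folklore] -/
theorem norm_mul_tateJ_sub_one_le {q : ℚ_[2]} (hq0 : q ≠ 0) (hq : ‖q‖ ≤ 2⁻¹) :
    ‖q * tateJ q - 1‖ ≤ 8⁻¹ := by
  have hq1 : ‖q‖ < 1 := hq.trans_lt (by norm_num)
  have hs := hasSum_coeff_formalXJ hq0 hq1
  -- split off the constant term
  have hs' := (hasSum_nat_add_iff' 1).mpr hs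
  rw [Finset.sum_range_one, coeff_zero_formalXJ, pow_zero, mul_one, Int.cast_one] at hs'
  rw [← hs'.tsum_eq]
  exact norm_tsum_le_of_forall_le_of_nonneg (by norm_num) fun n ↦ norm_coeff_formalXJ_mul_pow_succ_le hq n

end Summit.BirchSwinnertonDyer.BirchSwinnertonDyer.Theorems.MultTowerNS2

end
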